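import Summits.AnomalousDissipation.AnomalousDissipation.Theorems.SawtoothPulseCascadeK1LocalisedCascadeTailGeom

/-!
# K1loc — helper: GEOMETRIC MAJORANTS OF THE THIN / FLAT-SHELL JUNK SHAPES ALONG THE TAIL (numeric layer, typed tools)

Helper file of the prover lane on the crux `K1LocalisedCascade` (stmt-AnomalousDissipation-19491), route `SawtoothPulseCascade`
(S-B/S-C assembly seat; the LEDGER ASSEMBLY, thin tail; companion of `…TailGeom`, which has the tools, the zone product and the far
terms).  Along the thin tail (`…PhaseStepThin`; phase `j = j₀ + i`, `k_j = k₁₂·61^i`, `N_j = N₁2^i`, `η_j = η₁ρ^i`, `ε_j = ε₀/2^i`,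
`M_b = M₀ + μi`) each of the five terms of the thin junk shape (`…ThinJunkNumeric.thinJunk_le`) and of the flat-shell (oscillatory)
junk shape (`…OscJunkBounds.oscJunk_le'`) decays at least like `(9/16)^i` (`N/D ∝ (2/61)^i`, `ηΛ2^{M_b}/N ∝ (1/4)^i`, zone product
`≤ y₀(17/32)^i`, affine block counts absorbed by `(1+i)x^i ≤ θ^i` for `x ≤ θ/2` and `(1+i)(17/18)^i ≤ 19`), so that ONE rational
certificate at `i = 0` bounds the amplitude by `w·(3/4)^i` for every `i`:
* `sqrt_thinJunk_geom_le` (strip / low-fibre / ratio thin windows), `sqrt_oscJunk_geom_le` (flat-shell windows).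
No definitions; no statement about the crux. [cite: Grafakos2014, Prop. 3.2.7 (3)] [problem: turb]
-/

-- `Summit.<Summit>.<Problem>`: single-conjunct summit, the duplicate namespace segment is deliberate.
set_option linter.dupNamespace false

noncomputable section

namespace Summit.AnomalousDissipation.AnomalousDissipation.Theorems.SawtoothPulseCascade.K1Window

open Real
open Literature.Analysis.FluidPDE.SawtoothCascade Literature.Analysis.FluidPDE.SawtoothCascade.CascadeParams

/-! ## §1 The thin junk shape along the tail -/

set_option maxHeartbeats 400000 in
/-- **THE THIN JUNK ALONG THE TAIL IS GEOMETRIC**: at the phase with `0 ≤ A ≤ A₁`, `D ≥ D₁·61^i` (`D₁ > 0`), `N = N₁2^i`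
(`N₁ > 0`), `0 ≤ Λ ≤ Λ₁61^i`, `0 < η ≤ η₁(1/(2^{μ+1}·61))^i`, `M_b = M₀ + μi`, `G ≥ 0`, `0 ≤ c_k ≤ c_k′(1+i)`, zone product
`0 ≤ Z ≤ y₀(17/32)^i`, and ONE rational certificate `4y₀/(3.141592D₁) ≤ s²`, `(A₁·3.1416·G·η₁Λ₁/N₁·2^{M₀})² ≤ e₀`,
`3r²((4/3)e₀ + c₁′(2N₁/(3.141592D₁))² + c₂′·4N₁A₁/(3.141592D₁) + c₃′(8N₁A₁²s + 19·8A₁²y₀/3.141592)) ≤ w²` (`s, w ≥ 0`):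
`√(3r²((4/3)(AπGηΛ/N·2^{M_b})² + c₁(2N/(πD))² + c₂·4NA/(πD) + c₃(8NA²√(4Z/(πD)) + 8A²Z/π))) ≤ w·(3/4)^i`. [folklore] -/
theorem sqrt_thinJunk_geom_le (P : CascadeParams) (i : ℕ) {j : ℕ}
    {r A A₁ D D₁ N N₁ Λ Λ₁ η η₁ G c₁ c₂ c₃ c₁' c₂' c₃' y₀ s e₀ w : ℝ} {Mb Mb₀ μ : ℕ}
    (hA0 : 0 ≤ A) (hA : A ≤ A₁) (hD₁ : 0 < D₁) (hD : D₁ * 61 ^ i ≤ D) (hN₁ : 0 < N₁) (hN : N = N₁ * 2 ^ i)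
    (hΛ0 : 0 ≤ Λ) (hΛ : Λ ≤ Λ₁ * 61 ^ i) (hη : 0 < η) (hηle : η ≤ η₁ * (1 / (2 ^ (μ + 1) * 61)) ^ i) (hMb : Mb = Mb₀ + μ * i)
    (hG : 0 ≤ G) (hc₁0 : 0 ≤ c₁) (hc₁ : c₁ ≤ c₁' * (1 + i)) (hc₂0 : 0 ≤ c₂) (hc₂ : c₂ ≤ c₂' * (1 + i)) (hc₃0 : 0 ≤ c₃)
    (hc₃ : c₃ ≤ c₃' * (1 + i))
    (hy0 : 0 ≤ max 1 (Real.sqrt (2 * Real.log (1 / η))) * P.δ j)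
    (hy : max 1 (Real.sqrt (2 * Real.log (1 / η))) * P.δ j ≤ y₀ * (17 / 32 : ℝ) ^ i)
    (hs0 : 0 ≤ s) (hs : 4 * y₀ / (3.141592 * D₁) ≤ s ^ 2) (he : (A₁ * 3.1416 * G * η₁ * Λ₁ / N₁ * 2 ^ Mb₀) ^ 2 ≤ e₀) (hw : 0 ≤ w)
    (hJ : 3 * r ^ 2 * (4 / 3 * e₀ + c₁' * (2 * N₁ / (3.141592 * D₁)) ^ 2 + c₂' * (4 * N₁ * A₁ / (3.141592 * D₁)) +
        c₃' * (8 * N₁ * A₁ ^ 2 * s + 19 * (8 * A₁ ^ 2 * y₀ / 3.141592))) ≤ w ^ 2) :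
    Real.sqrt (3 * r ^ 2 * (4 / 3 * (A * π * G * η * Λ / N * 2 ^ Mb) ^ 2 + c₁ * (2 * N / (π * D)) ^ 2 + c₂ * (4 * N * A / (π * D)) +
        c₃ * (8 * N * A ^ 2 * Real.sqrt (4 * (max 1 (Real.sqrt (2 * Real.log (1 / η))) * P.δ j) / (π * D)) +
          8 * A ^ 2 * (max 1 (Real.sqrt (2 * Real.log (1 / η))) * P.δ j) / π))) ≤ w * (3 / 4 : ℝ) ^ i := by
  set Z : ℝ := max 1 (Real.sqrt (2 * Real.log (1 / η))) * P.δ j with hZ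
  set Θ : ℝ := 9 / 16 with hΘ
  have hΘi : (0 : ℝ) ≤ Θ ^ i := by positivity
  have hπlo := Real.pi_gt_d6
  have hπhi := Real.pi_lt_d4
  have hπ0 : (0 : ℝ) < 3.141592 := by norm_num
  have h61 : (0 : ℝ) < 61 ^ i := by positivity
  have h2i : (0 : ℝ) < 2 ^ i := by positivity
  have hD' : 0 < D₁ * 61 ^ i := by positivity
  have hDpos : 0 < D := lt_of_lt_of_le hD' hD
  have hπD : 3.141592 * (D₁ * 61 ^ i) ≤ π * D := mul_le_mul hπlo.le hD hD'.le Real.pi_pos.le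
  have hπD0 : 0 < 3.141592 * (D₁ * 61 ^ i) := by positivity
  have hA₁ : 0 ≤ A₁ := hA0.trans hA
  have hNpos : 0 < N := by rw [hN]; positivity
  have hi : (0 : ℝ) ≤ i := Nat.cast_nonneg i
  have hi1 : (0 : ℝ) ≤ 1 + i := by positivity
  have hη₁ : 0 < η₁ := by
    by_contra hneg
    have : η₁ * (1 / (2 ^ (μ + 1) * 61)) ^ i ≤ 0 := mul_nonpos_of_nonpos_of_nonneg (not_lt.mp hneg) (by positivity)
    linarith
  have hΛ₁ : 0 ≤ Λ₁ := by
    by_contra hneg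
    have : Λ₁ * 61 ^ i < 0 := mul_neg_of_neg_of_pos (not_le.mp hneg) h61
    linarith
  have hy₀ : 0 ≤ y₀ := by
    have : 0 ≤ y₀ * (17 / 32 : ℝ) ^ i := hy0.trans hy
    by_contra hneg
    have : y₀ * (17 / 32 : ℝ) ^ i < 0 := mul_neg_of_neg_of_pos (not_le.mp hneg) (by positivity)
    linarith
  have hc₁' : 0 ≤ c₁' := by
    by_contra hneg
    have : c₁' * (1 + i) < 0 := mul_neg_of_neg_of_pos (not_le.mp hneg) (by positivity)
    linarith
  have hc₂' : 0 ≤ c₂' := by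
    by_contra hneg
    have : c₂' * (1 + i) < 0 := mul_neg_of_neg_of_pos (not_le.mp hneg) (by positivity)
    linarith
  have hc₃' : 0 ≤ c₃' := by
    by_contra hneg
    have : c₃' * (1 + i) < 0 := mul_neg_of_neg_of_pos (not_le.mp hneg) (by positivity)
    linarith
  -- N/D along the tail
  have hND : N / (π * D) ≤ N₁ / (3.141592 * D₁) * (2 / 61 : ℝ) ^ i := by
    rw [hN]
    calc N₁ * 2 ^ i / (π * D) ≤ N₁ * 2 ^ i / (3.141592 * (D₁ * 61 ^ i)) :=
          div_le_div_of_nonneg_left (by positivity) hπD0 hπD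
      _ = N₁ / (3.141592 * D₁) * (2 / 61 : ℝ) ^ i := by rw [div_pow]; field_simp
  have hND0 : 0 ≤ N / (π * D) := by positivity
  -- term 1: the rounding target
  have hρ61 : (1 / (2 ^ (μ + 1) * 61) : ℝ) ^ i * 61 ^ i * (2 ^ μ) ^ i / 2 ^ i = (1 / 4 : ℝ) ^ i := by
    rw [← mul_pow, ← mul_pow, ← div_pow]; congr 1; rw [pow_succ]; field_simp; ring
  have t1a : η * Λ / N * 2 ^ Mb ≤ η₁ * Λ₁ / N₁ * 2 ^ Mb₀ * (1 / 4 : ℝ) ^ i := by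
    have h1 : η * Λ ≤ (η₁ * (1 / (2 ^ (μ + 1) * 61)) ^ i) * (Λ₁ * 61 ^ i) := mul_le_mul hηle hΛ hΛ0 (by positivity)
    rw [hN, hMb, pow_add, pow_mul]
    calc η * Λ / (N₁ * 2 ^ i) * (2 ^ Mb₀ * (2 ^ μ) ^ i) ≤
        (η₁ * (1 / (2 ^ (μ + 1) * 61)) ^ i) * (Λ₁ * 61 ^ i) / (N₁ * 2 ^ i) * (2 ^ Mb₀ * (2 ^ μ) ^ i) := by
          gcongr
      _ = η₁ * Λ₁ / N₁ * 2 ^ Mb₀ * ((1 / (2 ^ (μ + 1) * 61) : ℝ) ^ i * 61 ^ i * (2 ^ μ) ^ i / 2 ^ i) := by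
          field_simp
      _ = η₁ * Λ₁ / N₁ * 2 ^ Mb₀ * (1 / 4 : ℝ) ^ i := by rw [hρ61]
  have hηΛ0 : 0 ≤ η * Λ / N * 2 ^ Mb := by positivity
  have hbase0 : 0 ≤ η₁ * Λ₁ / N₁ * 2 ^ Mb₀ * (1 / 4 : ℝ) ^ i := hηΛ0.trans t1a
  have t1b : A * π * G * η * Λ / N * 2 ^ Mb ≤ A₁ * 3.1416 * G * (η₁ * Λ₁ / N₁ * 2 ^ Mb₀) * (1 / 4 : ℝ) ^ i := by
    have h1 : A * π ≤ A₁ * 3.1416 := mul_le_mul hA hπhi.le Real.pi_pos.le hA₁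
    calc A * π * G * η * Λ / N * 2 ^ Mb = (A * π) * G * (η * Λ / N * 2 ^ Mb) := by ring
      _ ≤ (A₁ * 3.1416) * G * (η₁ * Λ₁ / N₁ * 2 ^ Mb₀ * (1 / 4 : ℝ) ^ i) := by gcongr
      _ = _ := by ring
  have t1 : 4 / 3 * (A * π * G * η * Λ / N * 2 ^ Mb) ^ 2 ≤ 4 / 3 * e₀ * Θ ^ i := by
    have h0 : 0 ≤ A * π * G * η * Λ / N * 2 ^ Mb := by positivity
    have h1 := pow_le_pow_left₀ h0 t1b 2
    have h2 : (A₁ * 3.1416 * G * (η₁ * Λ₁ / N₁ * 2 ^ Mb₀) * (1 / 4 : ℝ) ^ i) ^ 2 =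
        (A₁ * 3.1416 * G * η₁ * Λ₁ / N₁ * 2 ^ Mb₀) ^ 2 * ((1 / 16 : ℝ)) ^ i := by
      rw [mul_pow, ← pow_mul, mul_comm i 2, pow_mul]; norm_num; ring
    have h3 : ((1 / 16 : ℝ)) ^ i ≤ Θ ^ i := pow_le_pow_left₀ (by norm_num) (by norm_num [hΘ]) i
    have he0 : 0 ≤ e₀ := le_trans (sq_nonneg _) he
    have h4 : (A₁ * 3.1416 * G * η₁ * Λ₁ / N₁ * 2 ^ Mb₀) ^ 2 * ((1 / 16 : ℝ)) ^ i ≤ e₀ * Θ ^ i :=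
      mul_le_mul he h3 (by positivity) he0
    rw [h2] at h1
    linarith [h1, h4]
  -- term 2
  have t2 : c₁ * (2 * N / (π * D)) ^ 2 ≤ c₁' * (2 * N₁ / (3.141592 * D₁)) ^ 2 * Θ ^ i := by
    have h1 : 2 * N / (π * D) ≤ 2 * (N₁ / (3.141592 * D₁)) * (2 / 61 : ℝ) ^ i := by
      have := mul_le_mul_of_nonneg_left hND (by norm_num : (0 : ℝ) ≤ 2)
      calc 2 * N / (π * D) = 2 * (N / (π * D)) := by ring
        _ ≤ 2 * (N₁ / (3.141592 * D₁) * (2 / 61 : ℝ) ^ i) := this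
        _ = _ := by ring
    have h2 := pow_le_pow_left₀ (by positivity) h1 2
    have h3 : (2 * (N₁ / (3.141592 * D₁)) * (2 / 61 : ℝ) ^ i) ^ 2 = (2 * N₁ / (3.141592 * D₁)) ^ 2 * ((4 / 3721 : ℝ)) ^ i := by
      rw [mul_pow, ← pow_mul, mul_comm i 2, pow_mul]; norm_num; ring
    rw [h3] at h2
    have h4 := one_add_natCast_mul_pow_le_pow (x := (4 / 3721 : ℝ)) (θ := Θ) (by norm_num) (by norm_num [hΘ]) i
    have h5 : 0 ≤ (2 * N₁ / (3.141592 * D₁)) ^ 2 := sq_nonneg _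
    calc c₁ * (2 * N / (π * D)) ^ 2 ≤ (c₁' * (1 + i)) * ((2 * N₁ / (3.141592 * D₁)) ^ 2 * (4 / 3721 : ℝ) ^ i) :=
          mul_le_mul hc₁ h2 (sq_nonneg _) (by positivity)
      _ = c₁' * (2 * N₁ / (3.141592 * D₁)) ^ 2 * ((1 + i) * (4 / 3721 : ℝ) ^ i) := by ring
      _ ≤ c₁' * (2 * N₁ / (3.141592 * D₁)) ^ 2 * Θ ^ i := mul_le_mul_of_nonneg_left h4 (by positivity)
  -- term 3
  have t3 : c₂ * (4 * N * A / (π * D)) ≤ c₂' * (4 * N₁ * A₁ / (3.141592 * D₁)) * Θ ^ i := by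
    have h1 : 4 * N * A / (π * D) ≤ 4 * A₁ * (N₁ / (3.141592 * D₁) * (2 / 61 : ℝ) ^ i) := by
      have : 4 * N * A / (π * D) = 4 * A * (N / (π * D)) := by ring
      rw [this]
      exact mul_le_mul (by linarith) hND hND0 (by positivity)
    have h4 := one_add_natCast_mul_pow_le_pow (x := (2 / 61 : ℝ)) (θ := Θ) (by norm_num) (by norm_num [hΘ]) i
    have h5 : 0 ≤ 4 * N₁ * A₁ / (3.141592 * D₁) := by positivity
    calc c₂ * (4 * N * A / (π * D)) ≤ (c₂' * (1 + i)) * (4 * A₁ * (N₁ / (3.141592 * D₁) * (2 / 61 : ℝ) ^ i)) :=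
          mul_le_mul hc₂ h1 (by positivity) (by positivity)
      _ = c₂' * (4 * N₁ * A₁ / (3.141592 * D₁)) * ((1 + i) * (2 / 61 : ℝ) ^ i) := by ring
      _ ≤ c₂' * (4 * N₁ * A₁ / (3.141592 * D₁)) * Θ ^ i := mul_le_mul_of_nonneg_left h4 (by positivity)
  -- term 4: the zone layer
  have hZle : Z ≤ y₀ * (17 / 32 : ℝ) ^ i := hy
  have t4a : Real.sqrt (4 * Z / (π * D)) ≤ s * (9 / 64 : ℝ) ^ i := by
    refine Real.sqrt_le_iff.mpr ⟨by positivity, ?_⟩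
    have h1 : 4 * Z / (π * D) ≤ 4 * (y₀ * (17 / 32 : ℝ) ^ i) / (3.141592 * (D₁ * 61 ^ i)) :=
      (div_le_div_of_nonneg_left (by positivity) hπD0 hπD).trans (div_le_div_of_nonneg_right (by linarith) hπD0.le)
    have h2 : 4 * (y₀ * (17 / 32 : ℝ) ^ i) / (3.141592 * (D₁ * 61 ^ i)) = 4 * y₀ / (3.141592 * D₁) * ((17 / 1952 : ℝ)) ^ i := by
      rw [show ((17 / 1952 : ℝ)) ^ i = (17 / 32 : ℝ) ^ i / 61 ^ i by rw [← div_pow]; norm_num]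
      field_simp
    have h3 : ((17 / 1952 : ℝ)) ^ i ≤ ((81 / 4096 : ℝ)) ^ i := pow_le_pow_left₀ (by norm_num) (by norm_num) i
    have h4 : (s * (9 / 64 : ℝ) ^ i) ^ 2 = s ^ 2 * (81 / 4096 : ℝ) ^ i := by
      rw [mul_pow, ← pow_mul, mul_comm i 2, pow_mul]; norm_num
    rw [h4]
    refine (h1.trans (le_of_eq h2)).trans ?_
    exact mul_le_mul hs h3 (by positivity) (sq_nonneg _)
  have t4 : c₃ * (8 * N * A ^ 2 * Real.sqrt (4 * Z / (π * D))) ≤ c₃' * (8 * N₁ * A₁ ^ 2 * s) * Θ ^ i := by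
    have hAA : A ^ 2 ≤ A₁ ^ 2 := pow_le_pow_left₀ hA0 hA 2
    have h1 : 8 * N * A ^ 2 * Real.sqrt (4 * Z / (π * D)) ≤ 8 * (N₁ * 2 ^ i) * A₁ ^ 2 * (s * (9 / 64 : ℝ) ^ i) := by
      rw [hN]
      exact mul_le_mul (mul_le_mul_of_nonneg_left hAA (by positivity)) t4a (Real.sqrt_nonneg _) (by positivity)
    have h2 : 8 * (N₁ * 2 ^ i) * A₁ ^ 2 * (s * (9 / 64 : ℝ) ^ i) = 8 * N₁ * A₁ ^ 2 * s * ((9 / 32 : ℝ)) ^ i := by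
      rw [show (9 / 32 : ℝ) = 2 * (9 / 64) by norm_num, mul_pow]; ring
    rw [h2] at h1
    have h4 := one_add_natCast_mul_pow_le_pow (x := (9 / 32 : ℝ)) (θ := Θ) (by norm_num) (by norm_num [hΘ]) i
    have h5 : 0 ≤ 8 * N₁ * A₁ ^ 2 * s := by positivity
    calc c₃ * (8 * N * A ^ 2 * Real.sqrt (4 * Z / (π * D))) ≤ (c₃' * (1 + i)) * (8 * N₁ * A₁ ^ 2 * s * (9 / 32 : ℝ) ^ i) :=
          mul_le_mul hc₃ h1 (by positivity) (by positivity)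
      _ = c₃' * (8 * N₁ * A₁ ^ 2 * s) * ((1 + i) * (9 / 32 : ℝ) ^ i) := by ring
      _ ≤ c₃' * (8 * N₁ * A₁ ^ 2 * s) * Θ ^ i := mul_le_mul_of_nonneg_left h4 (by positivity)
  -- term 5: the zone mass
  have t5 : c₃ * (8 * A ^ 2 * Z / π) ≤ c₃' * (19 * (8 * A₁ ^ 2 * y₀ / 3.141592)) * Θ ^ i := by
    have hAA : A ^ 2 ≤ A₁ ^ 2 := pow_le_pow_left₀ hA0 hA 2
    have hZ0 : 0 ≤ Z := hy0
    have h1 : 8 * A ^ 2 * Z / π ≤ 8 * A₁ ^ 2 * (y₀ * (17 / 32 : ℝ) ^ i) / 3.141592 := by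
      calc 8 * A ^ 2 * Z / π ≤ 8 * A ^ 2 * Z / 3.141592 := div_le_div_of_nonneg_left (by positivity) hπ0 hπlo.le
        _ ≤ 8 * A₁ ^ 2 * (y₀ * (17 / 32 : ℝ) ^ i) / 3.141592 :=
            div_le_div_of_nonneg_right (mul_le_mul (by linarith) hZle hZ0 (by positivity)) hπ0.le
    have e17 : ((17 / 32 : ℝ)) ^ i = ((17 / 18 : ℝ)) ^ i * Θ ^ i := by rw [← mul_pow]; norm_num [hΘ]
    have h4 : (1 + (i : ℝ)) * (17 / 18 : ℝ) ^ i ≤ 19 := by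
      have := one_add_natCast_mul_pow_le (ρ := (17 / 18 : ℝ)) (by norm_num) (by norm_num) i
      norm_num at this; linarith
    have h5 : 0 ≤ 8 * A₁ ^ 2 * y₀ / 3.141592 := by positivity
    have h6 : 0 ≤ ((17 / 18 : ℝ)) ^ i := by positivity
    calc c₃ * (8 * A ^ 2 * Z / π) ≤ (c₃' * (1 + i)) * (8 * A₁ ^ 2 * (y₀ * (17 / 32 : ℝ) ^ i) / 3.141592) :=
          mul_le_mul hc₃ h1 (by positivity) (by positivity)
      _ = c₃' * (8 * A₁ ^ 2 * y₀ / 3.141592) * ((1 + i) * (17 / 18 : ℝ) ^ i) * Θ ^ i := by rw [e17]; ring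
      _ ≤ c₃' * (8 * A₁ ^ 2 * y₀ / 3.141592) * 19 * Θ ^ i := by gcongr
      _ = c₃' * (19 * (8 * A₁ ^ 2 * y₀ / 3.141592)) * Θ ^ i := by ring
  -- assemble
  have hr : 0 ≤ 3 * r ^ 2 := by positivity
  have hsum : 3 * r ^ 2 * (4 / 3 * (A * π * G * η * Λ / N * 2 ^ Mb) ^ 2 + c₁ * (2 * N / (π * D)) ^ 2 + c₂ * (4 * N * A / (π * D)) +
      c₃ * (8 * N * A ^ 2 * Real.sqrt (4 * Z / (π * D)) + 8 * A ^ 2 * Z / π)) ≤ w ^ 2 * Θ ^ i := by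
    have h1 : 4 / 3 * (A * π * G * η * Λ / N * 2 ^ Mb) ^ 2 + c₁ * (2 * N / (π * D)) ^ 2 + c₂ * (4 * N * A / (π * D)) +
        c₃ * (8 * N * A ^ 2 * Real.sqrt (4 * Z / (π * D)) + 8 * A ^ 2 * Z / π) ≤
        (4 / 3 * e₀ + c₁' * (2 * N₁ / (3.141592 * D₁)) ^ 2 + c₂' * (4 * N₁ * A₁ / (3.141592 * D₁)) +
          c₃' * (8 * N₁ * A₁ ^ 2 * s + 19 * (8 * A₁ ^ 2 * y₀ / 3.141592))) * Θ ^ i := by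
      have eR : (4 / 3 * e₀ + c₁' * (2 * N₁ / (3.141592 * D₁)) ^ 2 + c₂' * (4 * N₁ * A₁ / (3.141592 * D₁)) +
          c₃' * (8 * N₁ * A₁ ^ 2 * s + 19 * (8 * A₁ ^ 2 * y₀ / 3.141592))) * Θ ^ i =
          4 / 3 * e₀ * Θ ^ i + c₁' * (2 * N₁ / (3.141592 * D₁)) ^ 2 * Θ ^ i + c₂' * (4 * N₁ * A₁ / (3.141592 * D₁)) * Θ ^ i +
            (c₃' * (8 * N₁ * A₁ ^ 2 * s) * Θ ^ i + c₃' * (19 * (8 * A₁ ^ 2 * y₀ / 3.141592)) * Θ ^ i) := by ring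
      rw [eR, mul_add c₃]; linarith [t1, t2, t3, t4, t5]
    calc _ ≤ 3 * r ^ 2 * ((4 / 3 * e₀ + c₁' * (2 * N₁ / (3.141592 * D₁)) ^ 2 + c₂' * (4 * N₁ * A₁ / (3.141592 * D₁)) +
          c₃' * (8 * N₁ * A₁ ^ 2 * s + 19 * (8 * A₁ ^ 2 * y₀ / 3.141592))) * Θ ^ i) := mul_le_mul_of_nonneg_left h1 hr
      _ = 3 * r ^ 2 * (4 / 3 * e₀ + c₁' * (2 * N₁ / (3.141592 * D₁)) ^ 2 + c₂' * (4 * N₁ * A₁ / (3.141592 * D₁)) +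
          c₃' * (8 * N₁ * A₁ ^ 2 * s + 19 * (8 * A₁ ^ 2 * y₀ / 3.141592))) * Θ ^ i := by ring
      _ ≤ w ^ 2 * Θ ^ i := mul_le_mul_of_nonneg_right hJ hΘi
  have e : w ^ 2 * Θ ^ i = (w * (3 / 4 : ℝ) ^ i) ^ 2 := by
    rw [mul_pow, ← pow_mul, mul_comm i 2, pow_mul]; norm_num [hΘ]
  exact Real.sqrt_le_iff.mpr ⟨by positivity, hsum.trans (le_of_eq e)⟩

/-! ## §2 The oscillatory (flat-shell) junk shape along the tail -/

set_option maxHeartbeats 400000 in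
/-- **THE FLAT-SHELL JUNK ALONG THE TAIL IS GEOMETRIC** (rate `θ ≥ 3/4`, zone rate `0 ≤ ρ_y < θ²`): `0 ≤ ε ≤ ε₀/2^i`,
`0 ≤ N ≤ N₁2^i` (`N₁ ≥ 0`), `A ≥ 0`, `D ≥ D₁61^i` (`D₁ > 0`), `0 ≤ c ≤ c′(1+i)`, zone product `0 ≤ Z ≤ y₀ρ_y^i` (`y₀ ≥ 0`), certificate
`4y₀/(3.141592D₁) ≤ s²`,
`3r²((4/3)ε₀² + (4/3)(2N₁/(3.141592D₁))² + 8N₁A/(3.141592D₁) + c′(8N₁A²s + (1 + 1/(1 − ρ_y/θ²))·8A²y₀/3.141592)) ≤ w²` (`s, w ≥ 0`):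
`√(3r²((4/3)ε² + (4/3)(2N/(πD))² + 8NA/(πD) + c(8NA²√(4Z/(πD)) + 8A²Z/π))) ≤ w·θ^i` (also used level by level in the shell
chain, where `N = 2^{t'} ≤ 2^{10+i}`). [folklore] -/
theorem sqrt_oscJunk_geom_le (P : CascadeParams) (i : ℕ) {j : ℕ} {r ε ε₀ N N₁ A D D₁ c c' η y₀ s w θ ρy : ℝ}
    (hθ : 3 / 4 ≤ θ) (hθ1 : θ ≤ 1) (hρy0 : 0 ≤ ρy) (hρy : ρy < θ ^ 2)
    (hε0 : 0 ≤ ε) (hε : ε ≤ ε₀ * (1 / 2 : ℝ) ^ i) (hN₁ : 0 ≤ N₁) (hN0 : 0 ≤ N) (hN : N ≤ N₁ * 2 ^ i) (hA : 0 ≤ A) (hD₁ : 0 < D₁)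
    (hD : D₁ * 61 ^ i ≤ D) (hc0 : 0 ≤ c) (hc : c ≤ c' * (1 + i))
    (hy0 : 0 ≤ max 1 (Real.sqrt (2 * Real.log (1 / η))) * P.δ j)
    (hy : max 1 (Real.sqrt (2 * Real.log (1 / η))) * P.δ j ≤ y₀ * ρy ^ i) (hy₀ : 0 ≤ y₀)
    (hs0 : 0 ≤ s) (hs : 4 * y₀ / (3.141592 * D₁) ≤ s ^ 2) (hw : 0 ≤ w)
    (hJ : 3 * r ^ 2 * (4 / 3 * ε₀ ^ 2 + 4 / 3 * (2 * N₁ / (3.141592 * D₁)) ^ 2 + 8 * N₁ * A / (3.141592 * D₁) +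
        c' * (8 * N₁ * A ^ 2 * s + (1 + 1 / (1 - ρy / θ ^ 2)) * (8 * A ^ 2 * y₀ / 3.141592))) ≤ w ^ 2) :
    Real.sqrt (3 * r ^ 2 * (4 / 3 * ε ^ 2 + 4 / 3 * (2 * N / (π * D)) ^ 2 + 8 * N * A / (π * D) +
        c * (8 * N * A ^ 2 * Real.sqrt (4 * (max 1 (Real.sqrt (2 * Real.log (1 / η))) * P.δ j) / (π * D)) +
          8 * A ^ 2 * (max 1 (Real.sqrt (2 * Real.log (1 / η))) * P.δ j) / π))) ≤ w * θ ^ i := by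
  set Z : ℝ := max 1 (Real.sqrt (2 * Real.log (1 / η))) * P.δ j with hZ
  set Θ : ℝ := θ ^ 2 with hΘ
  have hθ0 : 0 < θ := by linarith
  have hΘ916 : 9 / 16 ≤ Θ := by rw [hΘ]; nlinarith
  have hΘpos : 0 < Θ := by linarith
  have hΘ1 : Θ ≤ 1 := by rw [hΘ]; nlinarith
  have hΘi : (0 : ℝ) ≤ Θ ^ i := by positivity
  have hπlo := Real.pi_gt_d6
  have hπ0 : (0 : ℝ) < 3.141592 := by norm_num
  have h2i : (0 : ℝ) < 2 ^ i := by positivity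
  have hD' : 0 < D₁ * 61 ^ i := by positivity
  have hDpos : 0 < D := lt_of_lt_of_le hD' hD
  have hπD : 3.141592 * (D₁ * 61 ^ i) ≤ π * D := mul_le_mul hπlo.le hD hD'.le Real.pi_pos.le
  have hπD0 : 0 < 3.141592 * (D₁ * 61 ^ i) := by positivity
  have hi : (0 : ℝ) ≤ i := Nat.cast_nonneg i
  have hc' : 0 ≤ c' := by
    by_contra hneg
    have : c' * (1 + i) < 0 := mul_neg_of_neg_of_pos (not_le.mp hneg) (by positivity)
    linarith
  have hε₀ : 0 ≤ ε₀ := by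
    have : 0 ≤ ε₀ * (1 / 2 : ℝ) ^ i := hε0.trans hε
    by_contra hneg
    have : ε₀ * (1 / 2 : ℝ) ^ i < 0 := mul_neg_of_neg_of_pos (not_le.mp hneg) (by positivity)
    linarith
  have hND : N / (π * D) ≤ N₁ / (3.141592 * D₁) * (2 / 61 : ℝ) ^ i := by
    calc N / (π * D) ≤ N₁ * 2 ^ i / (π * D) := div_le_div_of_nonneg_right hN (by positivity)
      _ ≤ N₁ * 2 ^ i / (3.141592 * (D₁ * 61 ^ i)) := div_le_div_of_nonneg_left (by positivity) hπD0 hπD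
      _ = N₁ / (3.141592 * D₁) * (2 / 61 : ℝ) ^ i := by rw [div_pow]; field_simp
  have hND0 : 0 ≤ N / (π * D) := by positivity
  -- term 1
  have t1 : 4 / 3 * ε ^ 2 ≤ 4 / 3 * ε₀ ^ 2 * Θ ^ i := by
    have h1 := pow_le_pow_left₀ hε0 hε 2
    have h2 : (ε₀ * (1 / 2 : ℝ) ^ i) ^ 2 = ε₀ ^ 2 * ((1 / 4 : ℝ)) ^ i := by
      rw [mul_pow, ← pow_mul, mul_comm i 2, pow_mul]; norm_num
    have h3 : ((1 / 4 : ℝ)) ^ i ≤ Θ ^ i := pow_le_pow_left₀ (by norm_num) (by linarith) i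
    rw [h2] at h1
    have h4 := mul_le_mul_of_nonneg_left h3 (sq_nonneg ε₀)
    linarith [h1, h4]
  -- term 2
  have t2 : 4 / 3 * (2 * N / (π * D)) ^ 2 ≤ 4 / 3 * (2 * N₁ / (3.141592 * D₁)) ^ 2 * Θ ^ i := by
    have h1 : 2 * N / (π * D) ≤ 2 * (N₁ / (3.141592 * D₁)) * (2 / 61 : ℝ) ^ i := by
      have := mul_le_mul_of_nonneg_left hND (by norm_num : (0 : ℝ) ≤ 2)
      calc 2 * N / (π * D) = 2 * (N / (π * D)) := by ring
        _ ≤ 2 * (N₁ / (3.141592 * D₁) * (2 / 61 : ℝ) ^ i) := this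
        _ = _ := by ring
    have h2 := pow_le_pow_left₀ (by positivity) h1 2
    have h3 : (2 * (N₁ / (3.141592 * D₁)) * (2 / 61 : ℝ) ^ i) ^ 2 = (2 * N₁ / (3.141592 * D₁)) ^ 2 * ((4 / 3721 : ℝ)) ^ i := by
      rw [mul_pow, ← pow_mul, mul_comm i 2, pow_mul]; norm_num; ring
    have h4 : ((4 / 3721 : ℝ)) ^ i ≤ Θ ^ i := pow_le_pow_left₀ (by norm_num) (by linarith) i
    rw [h3] at h2
    have h5 := mul_le_mul_of_nonneg_left h4 (sq_nonneg (2 * N₁ / (3.141592 * D₁)))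
    linarith [h2, h5]
  -- term 3
  have t3 : 8 * N * A / (π * D) ≤ 8 * N₁ * A / (3.141592 * D₁) * Θ ^ i := by
    have h1 : 8 * N * A / (π * D) ≤ 8 * A * (N₁ / (3.141592 * D₁) * (2 / 61 : ℝ) ^ i) := by
      have : 8 * N * A / (π * D) = 8 * A * (N / (π * D)) := by ring
      rw [this]
      exact mul_le_mul_of_nonneg_left hND (by positivity)
    have h4 : ((2 / 61 : ℝ)) ^ i ≤ Θ ^ i := pow_le_pow_left₀ (by norm_num) (by linarith) i
    have h5 : 0 ≤ 8 * N₁ * A / (3.141592 * D₁) := by positivity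
    calc 8 * N * A / (π * D) ≤ 8 * A * (N₁ / (3.141592 * D₁) * (2 / 61 : ℝ) ^ i) := h1
      _ = 8 * N₁ * A / (3.141592 * D₁) * (2 / 61 : ℝ) ^ i := by ring
      _ ≤ 8 * N₁ * A / (3.141592 * D₁) * Θ ^ i := mul_le_mul_of_nonneg_left h4 h5
  -- term 4 (`σ = Θ/4`)
  have hZle : Z ≤ y₀ * ρy ^ i := hy
  have hρyΘ : ρy ≤ Θ := hρy.le
  have t4a : Real.sqrt (4 * Z / (π * D)) ≤ s * (Θ / 4) ^ i := by
    refine Real.sqrt_le_iff.mpr ⟨by positivity, ?_⟩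
    have h1 : 4 * Z / (π * D) ≤ 4 * (y₀ * ρy ^ i) / (3.141592 * (D₁ * 61 ^ i)) :=
      (div_le_div_of_nonneg_left (by positivity) hπD0 hπD).trans (div_le_div_of_nonneg_right (by linarith) hπD0.le)
    have h2 : 4 * (y₀ * ρy ^ i) / (3.141592 * (D₁ * 61 ^ i)) = 4 * y₀ / (3.141592 * D₁) * (ρy / 61) ^ i := by
      rw [div_pow]; field_simp
    have h61 : ρy / 61 ≤ (Θ / 4) ^ 2 := by
      rw [div_le_iff₀ (by norm_num : (0 : ℝ) < 61)]
      have h' : Θ * (9 / 16) ≤ Θ * Θ := mul_le_mul_of_nonneg_left hΘ916 hΘpos.le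
      have h'' : Θ ≤ (Θ / 4) ^ 2 * 61 := by nlinarith [h']
      linarith
    have h3 : (ρy / 61) ^ i ≤ ((Θ / 4) ^ i) ^ 2 := by
      rw [← pow_mul, mul_comm, pow_mul]; exact pow_le_pow_left₀ (by positivity) h61 i
    have h4 : (s * (Θ / 4) ^ i) ^ 2 = s ^ 2 * ((Θ / 4) ^ i) ^ 2 := by ring
    rw [h4]
    refine (h1.trans (le_of_eq h2)).trans ?_
    exact mul_le_mul hs h3 (by positivity) (sq_nonneg _)
  have t4 : c * (8 * N * A ^ 2 * Real.sqrt (4 * Z / (π * D))) ≤ c' * (8 * N₁ * A ^ 2 * s) * Θ ^ i := by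
    have h1 : 8 * N * A ^ 2 * Real.sqrt (4 * Z / (π * D)) ≤ 8 * (N₁ * 2 ^ i) * A ^ 2 * (s * (Θ / 4) ^ i) :=
      mul_le_mul (mul_le_mul_of_nonneg_right (mul_le_mul_of_nonneg_left hN (by norm_num)) (sq_nonneg A)) t4a
        (Real.sqrt_nonneg _) (by positivity)
    have h2 : 8 * (N₁ * 2 ^ i) * A ^ 2 * (s * (Θ / 4) ^ i) = 8 * N₁ * A ^ 2 * s * (Θ / 2) ^ i := by
      rw [show Θ / 2 = 2 * (Θ / 4) by ring, mul_pow]; ring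
    rw [h2] at h1
    have h4 := one_add_natCast_mul_pow_le_pow (x := Θ / 2) (θ := Θ) (by positivity) le_rfl i
    have h5 : 0 ≤ 8 * N₁ * A ^ 2 * s := by positivity
    calc c * (8 * N * A ^ 2 * Real.sqrt (4 * Z / (π * D))) ≤ (c' * (1 + i)) * (8 * N₁ * A ^ 2 * s * (Θ / 2) ^ i) :=
          mul_le_mul hc h1 (by positivity) (by positivity)
      _ = c' * (8 * N₁ * A ^ 2 * s) * ((1 + i) * (Θ / 2) ^ i) := by ring
      _ ≤ c' * (8 * N₁ * A ^ 2 * s) * Θ ^ i := mul_le_mul_of_nonneg_left h4 (by positivity)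
  -- term 5
  have t5 : c * (8 * A ^ 2 * Z / π) ≤ c' * ((1 + 1 / (1 - ρy / θ ^ 2)) * (8 * A ^ 2 * y₀ / 3.141592)) * Θ ^ i := by
    have hZ0 : 0 ≤ Z := hy0
    have h1 : 8 * A ^ 2 * Z / π ≤ 8 * A ^ 2 * (y₀ * ρy ^ i) / 3.141592 := by
      calc 8 * A ^ 2 * Z / π ≤ 8 * A ^ 2 * Z / 3.141592 := div_le_div_of_nonneg_left (by positivity) hπ0 hπlo.le
        _ ≤ 8 * A ^ 2 * (y₀ * ρy ^ i) / 3.141592 :=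
            div_le_div_of_nonneg_right (mul_le_mul_of_nonneg_left hZle (by positivity)) hπ0.le
    have eρ : ρy ^ i = (ρy / Θ) ^ i * Θ ^ i := by
      rw [← mul_pow]; congr 1; field_simp
    have hq0 : 0 ≤ ρy / Θ := by positivity
    have hq1 : ρy / Θ < 1 := (div_lt_one hΘpos).mpr hρy
    have h4 : (1 + (i : ℝ)) * (ρy / Θ) ^ i ≤ 1 + 1 / (1 - ρy / θ ^ 2) := one_add_natCast_mul_pow_le hq0 hq1 i
    have h5 : 0 ≤ 8 * A ^ 2 * y₀ / 3.141592 := by positivity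
    have h6 : 0 ≤ (ρy / Θ) ^ i := by positivity
    calc c * (8 * A ^ 2 * Z / π) ≤ (c' * (1 + i)) * (8 * A ^ 2 * (y₀ * ρy ^ i) / 3.141592) :=
          mul_le_mul hc h1 (by positivity) (by positivity)
      _ = c' * (8 * A ^ 2 * y₀ / 3.141592) * ((1 + i) * (ρy / Θ) ^ i) * Θ ^ i := by rw [eρ]; ring
      _ ≤ c' * (8 * A ^ 2 * y₀ / 3.141592) * (1 + 1 / (1 - ρy / θ ^ 2)) * Θ ^ i := by gcongr
      _ = c' * ((1 + 1 / (1 - ρy / θ ^ 2)) * (8 * A ^ 2 * y₀ / 3.141592)) * Θ ^ i := by ring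
  have hr : 0 ≤ 3 * r ^ 2 := by positivity
  have hsum : 3 * r ^ 2 * (4 / 3 * ε ^ 2 + 4 / 3 * (2 * N / (π * D)) ^ 2 + 8 * N * A / (π * D) +
      c * (8 * N * A ^ 2 * Real.sqrt (4 * Z / (π * D)) + 8 * A ^ 2 * Z / π)) ≤ w ^ 2 * Θ ^ i := by
    have h1 : 4 / 3 * ε ^ 2 + 4 / 3 * (2 * N / (π * D)) ^ 2 + 8 * N * A / (π * D) +
        c * (8 * N * A ^ 2 * Real.sqrt (4 * Z / (π * D)) + 8 * A ^ 2 * Z / π) ≤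
        (4 / 3 * ε₀ ^ 2 + 4 / 3 * (2 * N₁ / (3.141592 * D₁)) ^ 2 + 8 * N₁ * A / (3.141592 * D₁) +
          c' * (8 * N₁ * A ^ 2 * s + (1 + 1 / (1 - ρy / θ ^ 2)) * (8 * A ^ 2 * y₀ / 3.141592))) * Θ ^ i := by
      have eR : (4 / 3 * ε₀ ^ 2 + 4 / 3 * (2 * N₁ / (3.141592 * D₁)) ^ 2 + 8 * N₁ * A / (3.141592 * D₁) +
          c' * (8 * N₁ * A ^ 2 * s + (1 + 1 / (1 - ρy / θ ^ 2)) * (8 * A ^ 2 * y₀ / 3.141592))) * Θ ^ i =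
          4 / 3 * ε₀ ^ 2 * Θ ^ i + 4 / 3 * (2 * N₁ / (3.141592 * D₁)) ^ 2 * Θ ^ i + 8 * N₁ * A / (3.141592 * D₁) * Θ ^ i +
            (c' * (8 * N₁ * A ^ 2 * s) * Θ ^ i + c' * ((1 + 1 / (1 - ρy / θ ^ 2)) * (8 * A ^ 2 * y₀ / 3.141592)) * Θ ^ i) := by
        ring
      rw [eR, mul_add c]; linarith [t1, t2, t3, t4, t5]
    calc _ ≤ 3 * r ^ 2 * ((4 / 3 * ε₀ ^ 2 + 4 / 3 * (2 * N₁ / (3.141592 * D₁)) ^ 2 + 8 * N₁ * A / (3.141592 * D₁) +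
          c' * (8 * N₁ * A ^ 2 * s + (1 + 1 / (1 - ρy / θ ^ 2)) * (8 * A ^ 2 * y₀ / 3.141592))) * Θ ^ i) :=
          mul_le_mul_of_nonneg_left h1 hr
      _ = 3 * r ^ 2 * (4 / 3 * ε₀ ^ 2 + 4 / 3 * (2 * N₁ / (3.141592 * D₁)) ^ 2 + 8 * N₁ * A / (3.141592 * D₁) +
          c' * (8 * N₁ * A ^ 2 * s + (1 + 1 / (1 - ρy / θ ^ 2)) * (8 * A ^ 2 * y₀ / 3.141592))) * Θ ^ i := by ring
      _ ≤ w ^ 2 * Θ ^ i := mul_le_mul_of_nonneg_right hJ hΘi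
  have e : w ^ 2 * Θ ^ i = (w * θ ^ i) ^ 2 := by rw [hΘ]; ring
  exact Real.sqrt_le_iff.mpr ⟨by positivity, hsum.trans (le_of_eq e)⟩

end Summit.AnomalousDissipation.AnomalousDissipation.Theorems.SawtoothPulseCascade.K1Window
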